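import Literature.NumberTheory.LFunctions.LargeValueBoundDensity
import Literature.NumberTheory.LFunctions.GuthMaynardLargeValuesTheorem
import HarnessLib

/-!
# Three rows of the large value table in `LV`-language: the mean value theorem, Huxley 1972, Guth–Maynard 2024

LABEL (line 1): **NOT RH-BEARING** — large value bounds for Dirichlet polynomials, restated in the
exponent language `LV(σ, τ) ≤ ρ` (`LargeValueBound`, Tao–Trudgian–Yang 2025 Definition 27); they
feed zero-density COUNTS, which never empty the strip
(`Literature.Barriers.RiemannHypothesis.LindelofBacklund`). RH-FREE literature. Nothing in this
file bears on the truth of RH.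

Topic `NumberTheory/LFunctions`, family RH; bears on the LADDER-RH §4 HELD row `DensityLadder`
(crux X1 `BeatThirtyThirteenths` is phrased as a gain in the third term `τ + 12/5 − 4σ` of the
Guth–Maynard row below). A leaf file (it imports the Guth–Maynard proof chain through
`GuthMaynardLargeValuesTheorem.lean`; kept out of `LargeValueBoundDensity.lean` to spare that
file the import).

Sources: T. Tao, T. Trudgian, A. Yang, arXiv:2501.16779 (2025), the displays before Theorem 32
(p. 13): Theorem 31 (`L²` mean value theorem) "`LV(σ,τ) ≤ max(2 − 2σ, 1 + τ − 2σ)`" and the Guth–Maynard row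
"`LV(σ,τ) ≤ max(2−2σ, 18/5 − 4σ, τ + 12/5 − 4σ)`" [`TaoTrudgianYang2025`]; L. Guth, J. Maynard,
Ann. of Math. (2) 203 (2026), Theorem 1.1 [`GuthMaynard2026`] — the tree THEOREM
`GuthMaynard2026_theorem_1_1_holds`; the mean value theorem for Dirichlet polynomials in the
tree's form `GuthMaynardReduction.largeValues_mvt` (Guth–Maynard (1.1), Montgomery 1971).

## What this file proves (theorems only; no definition, no named fact)

* `largeValueBound_guthMaynard` — `LargeValueBound σ τ (max (2−2σ) (max (18/5−4σ) (τ+12/5−4σ)))`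
  for `τ > 0`, from `GuthMaynard2026_theorem_1_1_holds`.
* `largeValueBound_meanValue` — `LargeValueBound σ τ (max (2−2σ) (1+τ−2σ))` for `τ > 0`, from
  `GuthMaynardReduction.largeValues_mvt`.
* `largeValueBound_huxley` — `LargeValueBound σ τ (max (2−2σ) (4+τ−6σ))` for `τ > 0`, from
  `GuthMaynardReduction.largeValues_hmh` (Huxley 1972; TTY item (i) after Theorem 31).
-/

noncomputable section

open Real Set Filter Topology Complex MeasureTheory Finset Asymptotics

namespace Literature.NumberTheory.LFunctions


/-- From a lower bound `N^x ≤ V` (`N > 0`) to `V⁻¹ ^ n ≤ N^{−xn}`; plumbing. [folklore] -/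
private lemma inv_pow_le_rpow_neg {N V x : ℝ} (hN : 0 < N) (hV : N ^ x ≤ V) (n : ℕ) :
    V⁻¹ ^ n ≤ N ^ (-(x * n)) := by
  have hNx : 0 < N ^ x := Real.rpow_pos_of_pos hN x
  have hV0 : 0 < V := lt_of_lt_of_le hNx hV
  have h1 : V⁻¹ ≤ (N ^ x)⁻¹ := inv_anti₀ hNx hV
  calc V⁻¹ ^ n ≤ ((N ^ x)⁻¹) ^ n := pow_le_pow_left₀ (inv_nonneg.2 hV0.le) h1 n
    _ = N ^ (-(x * n)) := by
        rw [← Real.rpow_neg hN.le, ← Real.rpow_natCast, ← Real.rpow_mul hN.le]; ring_nf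

/-- `T^{ε/(2(τ+1))} ≤ N^{ε/2}` when `0 < T ≤ N^{τ+δ}`, `N ≥ 1`, `0 ≤ δ ≤ 1`, `τ > 0`, `ε > 0`;
plumbing. [folklore] -/
private lemma rpow_small_le {N T τ δ ε : ℝ} (hN : 1 ≤ N) (hT0 : 0 < T) (hT : T ≤ N ^ (τ + δ))
    (hτ : 0 < τ) (hδ0 : 0 ≤ δ) (hδ1 : δ ≤ 1) (hε : 0 < ε) :
    T ^ (ε / (2 * (τ + 1))) ≤ N ^ (ε / 2) := by
  have hN0 : 0 < N := by linarith
  have h2 : (τ + δ) * (ε / (2 * (τ + 1))) ≤ ε / 2 := by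
    have h3 : (τ + δ) / (τ + 1) ≤ 1 := by rw [div_le_one (by positivity)]; linarith
    calc (τ + δ) * (ε / (2 * (τ + 1))) = ε / 2 * ((τ + δ) / (τ + 1)) := by field_simp
      _ ≤ ε / 2 * 1 := mul_le_mul_of_nonneg_left h3 (by positivity)
      _ = ε / 2 := mul_one _
  calc T ^ (ε / (2 * (τ + 1))) ≤ (N ^ (τ + δ)) ^ (ε / (2 * (τ + 1))) :=
        Real.rpow_le_rpow hT0.le hT (by positivity)
    _ = N ^ ((τ + δ) * (ε / (2 * (τ + 1)))) := by rw [← Real.rpow_mul hN0.le]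
    _ ≤ N ^ (ε / 2) := Real.rpow_le_rpow_of_exponent_le hN h2

/-- **Guth–Maynard's large values theorem as the bound
`LV(σ, τ) ≤ max(2 − 2σ, 18/5 − 4σ, τ + 12/5 − 4σ)`** (Tao–Trudgian–Yang: "`LV(σ,τ) ≤
max(2−2σ, 18/5 − 4σ, τ + 12/5 − 4σ)`"), for every real `σ` and `τ > 0`, PROVED from the tree THEOREM
`GuthMaynard2026_theorem_1_1_holds` (Guth–Maynard 2026, Theorem 1.1:
`#W ≤ C_ε T^ε (N²V⁻² + N^{18/5}V⁻⁴ + TN^{12/5}V⁻⁴)` for `1`-bounded coefficients, `1`-separated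
`W ⊂ [0,T]`, `|∑_{N ≤ n ≤ 2N} b_n n^{it}| ≥ V`) by the bookkeeping `T ≤ N^{τ+δ}`, `V ≥ N^{σ−δ}`,
`δ = min(τ/2, 1/4, ε/10)`: the three terms are `≤ N^{2−2σ+2δ}`, `N^{18/5−4σ+4δ}`,
`N^{τ+12/5−4σ+5δ}`. [cite: GuthMaynard2026, Theorem 1.1] [cite: TaoTrudgianYang2025, display (guth-maynard-lvt) before Theorem 32, p. 13] -/
theorem largeValueBound_guthMaynard {σ τ : ℝ} (hτ : 0 < τ) :
    LargeValueBound σ τ (max (2 - 2 * σ) (max (18 / 5 - 4 * σ) (τ + 12 / 5 - 4 * σ))) := by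
  intro ε hε
  obtain ⟨M, hM⟩ : ∃ M : ℝ, max (2 - 2 * σ) (max (18 / 5 - 4 * σ) (τ + 12 / 5 - 4 * σ)) = M :=
    ⟨_, rfl⟩
  have hM1 : 2 - 2 * σ ≤ M := by rw [← hM]; exact le_max_left _ _
  have hM2 : 18 / 5 - 4 * σ ≤ M := by rw [← hM]; exact (le_max_left _ _).trans (le_max_right _ _)
  have hM3 : τ + 12 / 5 - 4 * σ ≤ M := by
    rw [← hM]; exact (le_max_right _ _).trans (le_max_right _ _)
  rw [hM]
  obtain ⟨C, hC⟩ := GuthMaynard2026_theorem_1_1_holds (ε / (2 * (τ + 1))) (by positivity)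
  obtain ⟨δ, hδ⟩ : ∃ δ : ℝ, min (τ / 2) (min (1 / 4) (ε / 10)) = δ := ⟨_, rfl⟩
  have hδ0 : 0 < δ := by rw [← hδ]; positivity
  have hδτ : δ ≤ τ / 2 := by rw [← hδ]; exact min_le_left _ _
  have hδ4 : δ ≤ 1 / 4 := by rw [← hδ]; exact (min_le_right _ _).trans (min_le_left _ _)
  have hδε : δ ≤ ε / 10 := by rw [← hδ]; exact (min_le_right _ _).trans (min_le_right _ _)
  refine ⟨max 16 (3 * max C 0), δ, hδ0, fun N T V a W hN hT₁ hT₂ hV₁ hV₂ ha hW hsep hla ↦ ?_⟩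
  have hN16 : (16 : ℝ) ≤ N := (le_max_left _ _).trans hN
  have hN1 : (1 : ℝ) ≤ N := by linarith
  have hN0 : (0 : ℝ) < N := by linarith
  have hNnat : 1 ≤ N := by exact_mod_cast hN1
  have hT1 : 1 ≤ T := (Real.one_le_rpow hN1 (by linarith)).trans hT₁
  have hT0 : 0 < T := by linarith
  have hV0 : 0 < V := lt_of_lt_of_le (Real.rpow_pos_of_pos hN0 _) hV₁
  have hR := hC T hT1 N a V W hNnat ha hV0 hW hsep hla
  have hC0 : 0 ≤ max C 0 := le_max_right _ _
  have hA : T ^ (ε / (2 * (τ + 1))) ≤ (N : ℝ) ^ (ε / 2) :=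
    rpow_small_le hN1 hT0 hT₂ hτ hδ0.le (by linarith) hε
  -- the three monomials
  have i2 : V⁻¹ ^ 2 ≤ (N : ℝ) ^ (-((σ - δ) * (2 : ℕ))) := inv_pow_le_rpow_neg hN0 hV₁ 2
  have i4 : V⁻¹ ^ 4 ≤ (N : ℝ) ^ (-((σ - δ) * (4 : ℕ))) := inv_pow_le_rpow_neg hN0 hV₁ 4
  have t1 : (N : ℝ) ^ 2 * V⁻¹ ^ 2 ≤ (N : ℝ) ^ (M + ε / 2) := by
    calc (N : ℝ) ^ 2 * V⁻¹ ^ 2 ≤ (N : ℝ) ^ (2 : ℝ) * (N : ℝ) ^ (-((σ - δ) * (2 : ℕ))) := by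
          rw [← Real.rpow_two]; exact mul_le_mul_of_nonneg_left i2 (by positivity)
      _ = (N : ℝ) ^ (2 - 2 * σ + 2 * δ) := by rw [← Real.rpow_add hN0]; push_cast; ring_nf
      _ ≤ (N : ℝ) ^ (M + ε / 2) := Real.rpow_le_rpow_of_exponent_le hN1 (by linarith)
  have t2 : (N : ℝ) ^ (18 / 5 : ℝ) * V⁻¹ ^ 4 ≤ (N : ℝ) ^ (M + ε / 2) := by
    calc (N : ℝ) ^ (18 / 5 : ℝ) * V⁻¹ ^ 4
        ≤ (N : ℝ) ^ (18 / 5 : ℝ) * (N : ℝ) ^ (-((σ - δ) * (4 : ℕ))) :=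
          mul_le_mul_of_nonneg_left i4 (by positivity)
      _ = (N : ℝ) ^ (18 / 5 - 4 * σ + 4 * δ) := by rw [← Real.rpow_add hN0]; push_cast; ring_nf
      _ ≤ (N : ℝ) ^ (M + ε / 2) := Real.rpow_le_rpow_of_exponent_le hN1 (by linarith)
  have t3 : T * (N : ℝ) ^ (12 / 5 : ℝ) * V⁻¹ ^ 4 ≤ (N : ℝ) ^ (M + ε / 2) := by
    have h0 : 0 ≤ V⁻¹ ^ 4 := by positivity
    calc T * (N : ℝ) ^ (12 / 5 : ℝ) * V⁻¹ ^ 4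
        ≤ (N : ℝ) ^ (τ + δ) * (N : ℝ) ^ (12 / 5 : ℝ) * (N : ℝ) ^ (-((σ - δ) * (4 : ℕ))) := by
          gcongr
      _ = (N : ℝ) ^ (τ + δ + 12 / 5 - 4 * σ + 4 * δ) := by
          rw [← Real.rpow_add hN0, ← Real.rpow_add hN0]; push_cast; ring_nf
      _ ≤ (N : ℝ) ^ (M + ε / 2) := Real.rpow_le_rpow_of_exponent_le hN1 (by linarith)
  have hsum : (N : ℝ) ^ 2 * V⁻¹ ^ 2 + (N : ℝ) ^ (18 / 5 : ℝ) * V⁻¹ ^ 4 +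
      T * (N : ℝ) ^ (12 / 5 : ℝ) * V⁻¹ ^ 4 ≤ 3 * (N : ℝ) ^ (M + ε / 2) := by
    have h := add_le_add (add_le_add t1 t2) t3
    linarith
  have hS0 : 0 ≤ (N : ℝ) ^ 2 * V⁻¹ ^ 2 + (N : ℝ) ^ (18 / 5 : ℝ) * V⁻¹ ^ 4 +
      T * (N : ℝ) ^ (12 / 5 : ℝ) * V⁻¹ ^ 4 := by positivity
  have hNε : 0 ≤ (N : ℝ) ^ (ε / 2) := by positivity
  have step1 : (W.card : ℝ) ≤ max C 0 * T ^ (ε / (2 * (τ + 1))) *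
      ((N : ℝ) ^ 2 * V⁻¹ ^ 2 + (N : ℝ) ^ (18 / 5 : ℝ) * V⁻¹ ^ 4 +
        T * (N : ℝ) ^ (12 / 5 : ℝ) * V⁻¹ ^ 4) :=
    hR.trans (mul_le_mul_of_nonneg_right
      (mul_le_mul_of_nonneg_right (le_max_left _ _) (by positivity)) hS0)
  have step2 : max C 0 * T ^ (ε / (2 * (τ + 1))) *
      ((N : ℝ) ^ 2 * V⁻¹ ^ 2 + (N : ℝ) ^ (18 / 5 : ℝ) * V⁻¹ ^ 4 +
        T * (N : ℝ) ^ (12 / 5 : ℝ) * V⁻¹ ^ 4) ≤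
      max C 0 * (N : ℝ) ^ (ε / 2) * (3 * (N : ℝ) ^ (M + ε / 2)) :=
    (mul_le_mul_of_nonneg_right (mul_le_mul_of_nonneg_left hA hC0) hS0).trans
      (mul_le_mul_of_nonneg_left hsum (mul_nonneg hC0 hNε))
  have step3 : max C 0 * (N : ℝ) ^ (ε / 2) * (3 * (N : ℝ) ^ (M + ε / 2)) =
      3 * max C 0 * (N : ℝ) ^ (M + ε) := by
    have : (N : ℝ) ^ (M + ε) = (N : ℝ) ^ (ε / 2) * (N : ℝ) ^ (M + ε / 2) := by
      rw [← Real.rpow_add hN0]; ring_nf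
    rw [this]; ring
  have step4 : 3 * max C 0 * (N : ℝ) ^ (M + ε) ≤ max 16 (3 * max C 0) * (N : ℝ) ^ (M + ε) :=
    mul_le_mul_of_nonneg_right (le_max_right _ _) (by positivity)
  linarith

/-- **The mean value theorem row: `LV(σ, τ) ≤ max(2 − 2σ, 1 + τ − 2σ)`** (Tao–Trudgian–Yang,
Theorem 31 (`L²` mean value theorem): "For any fixed `1/2 ≤ σ ≤ 1` and `τ ≥ 0` one has
`LV(σ,τ) ≤ max(2−2σ, 1+τ−2σ)`"; `|W|V² ≪ N^{1+o(1)}(T + N)`), for `τ > 0`, PROVED from the tree theorem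
`GuthMaynardReduction.largeValues_mvt`
(`#W ≤ V⁻² (N+1)(5T + 3 + 36N)(1 + log 2N)`): `N + 1 ≤ 2N`, `5T + 3 + 36N ≤ 39(T + N)`,
`1 + log 2N ≤ (1 + 2/δ) N^δ` (`log x ≤ x^δ/δ`), then `T ≤ N^{τ+δ}`, `V ≥ N^{σ−δ}` with
`δ = min(τ/2, 1/4, ε/8)`. [cite: TaoTrudgianYang2025, Theorem 31 (L² mean value theorem), p. 13] [cite: GuthMaynard2026, display (1.1), first term] -/
theorem largeValueBound_meanValue {σ τ : ℝ} (hτ : 0 < τ) :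
    LargeValueBound σ τ (max (2 - 2 * σ) (1 + τ - 2 * σ)) := by
  intro ε hε
  obtain ⟨M, hM⟩ : ∃ M : ℝ, max (2 - 2 * σ) (1 + τ - 2 * σ) = M := ⟨_, rfl⟩
  have hM1 : 2 - 2 * σ ≤ M := by rw [← hM]; exact le_max_left _ _
  have hM2 : 1 + τ - 2 * σ ≤ M := by rw [← hM]; exact le_max_right _ _
  rw [hM]
  obtain ⟨δ, hδ⟩ : ∃ δ : ℝ, min (τ / 2) (min (1 / 4) (ε / 8)) = δ := ⟨_, rfl⟩
  have hδ0 : 0 < δ := by rw [← hδ]; positivity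
  have hδτ : δ ≤ τ / 2 := by rw [← hδ]; exact min_le_left _ _
  have hδ4 : δ ≤ 1 / 4 := by rw [← hδ]; exact (min_le_right _ _).trans (min_le_left _ _)
  have hδε : δ ≤ ε / 8 := by rw [← hδ]; exact (min_le_right _ _).trans (min_le_right _ _)
  obtain ⟨K, hK⟩ : ∃ K : ℝ, 78 * (1 + 2 / δ) = K := ⟨_, rfl⟩
  have hK0 : 0 ≤ K := by rw [← hK]; positivity
  refine ⟨max 16 (2 * K), δ, hδ0, fun N T V a W hN hT₁ hT₂ hV₁ hV₂ ha hW hsep hla ↦ ?_⟩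
  have hN16 : (16 : ℝ) ≤ N := (le_max_left _ _).trans hN
  have hN1 : (1 : ℝ) ≤ N := by linarith
  have hN0 : (0 : ℝ) < N := by linarith
  have hNnat : 1 ≤ N := by exact_mod_cast hN1
  have hT1 : 1 ≤ T := (Real.one_le_rpow hN1 (by linarith)).trans hT₁
  have hT0 : 0 < T := by linarith
  have hV0 : 0 < V := lt_of_lt_of_le (Real.rpow_pos_of_pos hN0 _) hV₁
  have hR := GuthMaynardReduction.largeValues_mvt hT1 hNnat ha hV0 W hW hsep hla
  -- elementary bounds for the three factors
  have hX0 : 0 ≤ V⁻¹ ^ 2 := by positivity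
  have hX : V⁻¹ ^ 2 ≤ (N : ℝ) ^ (-((σ - δ) * (2 : ℕ))) := inv_pow_le_rpow_neg hN0 hV₁ 2
  have b1 : (N : ℝ) + 1 ≤ 2 * N := by linarith
  have b2 : 5 * T + 3 + 36 * (N : ℝ) ≤ 39 * (T + N) := by linarith
  have hlog0 : 0 ≤ Real.log (2 * (N : ℝ)) := Real.log_nonneg (by linarith)
  have hNδ1 : 1 ≤ (N : ℝ) ^ δ := Real.one_le_rpow hN1 hδ0.le
  have b3 : 1 + Real.log (2 * (N : ℝ)) ≤ (1 + 2 / δ) * (N : ℝ) ^ δ := by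
    have h1 : Real.log (2 * (N : ℝ)) ≤ (2 * (N : ℝ)) ^ δ / δ :=
      Real.log_le_rpow_div (by linarith) hδ0
    have h2 : (2 * (N : ℝ)) ^ δ ≤ 2 * (N : ℝ) ^ δ := by
      rw [Real.mul_rpow (by norm_num) hN0.le]
      refine mul_le_mul_of_nonneg_right ?_ (by positivity)
      calc (2 : ℝ) ^ δ ≤ (2 : ℝ) ^ (1 : ℝ) :=
            Real.rpow_le_rpow_of_exponent_le (by norm_num) (by linarith)
        _ = 2 := Real.rpow_one 2
    have h3 : (2 * (N : ℝ)) ^ δ / δ ≤ 2 * (N : ℝ) ^ δ / δ :=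
      div_le_div_of_nonneg_right h2 hδ0.le
    have h4 : (1 + 2 / δ) * (N : ℝ) ^ δ = (N : ℝ) ^ δ + 2 * (N : ℝ) ^ δ / δ := by ring
    rw [h4]; linarith
  -- `#W ≤ K (V⁻² N T N^δ + V⁻² N N N^δ)`
  have hmain : (W.card : ℝ) ≤ K * (V⁻¹ ^ 2 * N * T * (N : ℝ) ^ δ + V⁻¹ ^ 2 * N * N * (N : ℝ) ^ δ) := by
    have h1 : ((N : ℝ) + 1) * ((5 * T + 3 + 36 * N) * (1 + Real.log (2 * (N : ℝ)))) ≤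
        (2 * N) * ((39 * (T + N)) * ((1 + 2 / δ) * (N : ℝ) ^ δ)) := by
      have h0 : 0 ≤ 1 + Real.log (2 * (N : ℝ)) := by linarith
      gcongr
    calc (W.card : ℝ) ≤ V⁻¹ ^ 2 * (((N : ℝ) + 1) * ((5 * T + 3 + 36 * N) *
          (1 + Real.log (2 * (N : ℝ))))) := hR
      _ ≤ V⁻¹ ^ 2 * ((2 * N) * ((39 * (T + N)) * ((1 + 2 / δ) * (N : ℝ) ^ δ))) :=
          mul_le_mul_of_nonneg_left h1 hX0
      _ = K * (V⁻¹ ^ 2 * N * T * (N : ℝ) ^ δ + V⁻¹ ^ 2 * N * N * (N : ℝ) ^ δ) := by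
          rw [← hK]; ring
  -- the two monomials
  have tA : V⁻¹ ^ 2 * N * T * (N : ℝ) ^ δ ≤ (N : ℝ) ^ (M + ε / 2) := by
    have hNδ0 : 0 ≤ (N : ℝ) ^ δ := by positivity
    calc V⁻¹ ^ 2 * N * T * (N : ℝ) ^ δ
        ≤ (N : ℝ) ^ (-((σ - δ) * (2 : ℕ))) * (N : ℝ) ^ (1 : ℝ) * (N : ℝ) ^ (τ + δ) * (N : ℝ) ^ δ := by
          rw [Real.rpow_one]; gcongr
      _ = (N : ℝ) ^ (1 + τ - 2 * σ + 4 * δ) := by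
          rw [← Real.rpow_add hN0, ← Real.rpow_add hN0, ← Real.rpow_add hN0]; push_cast; ring_nf
      _ ≤ (N : ℝ) ^ (M + ε / 2) := Real.rpow_le_rpow_of_exponent_le hN1 (by linarith)
  have tB : V⁻¹ ^ 2 * N * N * (N : ℝ) ^ δ ≤ (N : ℝ) ^ (M + ε / 2) := by
    have hNδ0 : 0 ≤ (N : ℝ) ^ δ := by positivity
    calc V⁻¹ ^ 2 * N * N * (N : ℝ) ^ δ
        ≤ (N : ℝ) ^ (-((σ - δ) * (2 : ℕ))) * (N : ℝ) ^ (1 : ℝ) * (N : ℝ) ^ (1 : ℝ) * (N : ℝ) ^ δ := by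
          rw [Real.rpow_one]; gcongr
      _ = (N : ℝ) ^ (2 - 2 * σ + 3 * δ) := by
          rw [← Real.rpow_add hN0, ← Real.rpow_add hN0, ← Real.rpow_add hN0]; push_cast; ring_nf
      _ ≤ (N : ℝ) ^ (M + ε / 2) := Real.rpow_le_rpow_of_exponent_le hN1 (by linarith)
  have hfin : (N : ℝ) ^ (M + ε / 2) ≤ (N : ℝ) ^ (M + ε) :=
    Real.rpow_le_rpow_of_exponent_le hN1 (by linarith)
  have hpos : 0 ≤ (N : ℝ) ^ (M + ε) := by positivity
  calc (W.card : ℝ) ≤ K * (V⁻¹ ^ 2 * N * T * (N : ℝ) ^ δ + V⁻¹ ^ 2 * N * N * (N : ℝ) ^ δ) := hmain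
    _ ≤ K * ((N : ℝ) ^ (M + ε) + (N : ℝ) ^ (M + ε)) :=
        mul_le_mul_of_nonneg_left (add_le_add (tA.trans hfin) (tB.trans hfin)) hK0
    _ = 2 * K * (N : ℝ) ^ (M + ε) := by ring
    _ ≤ max 16 (2 * K) * (N : ℝ) ^ (M + ε) := mul_le_mul_of_nonneg_right (le_max_right _ _) hpos

/-- `1 + log(2N) ≤ (1 + 2/δ) N^δ` for `N ≥ 1`, `0 < δ ≤ 1`; plumbing. [folklore] -/
private lemma one_add_log_le {N δ : ℝ} (hN : 1 ≤ N) (hδ0 : 0 < δ) (hδ1 : δ ≤ 1) :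
    1 + Real.log (2 * N) ≤ (1 + 2 / δ) * N ^ δ := by
  have hN0 : 0 < N := by linarith
  have hNδ1 : 1 ≤ N ^ δ := Real.one_le_rpow hN hδ0.le
  have h1 : Real.log (2 * N) ≤ (2 * N) ^ δ / δ := Real.log_le_rpow_div (by linarith) hδ0
  have h2 : (2 * N) ^ δ ≤ 2 * N ^ δ := by
    rw [Real.mul_rpow (by norm_num) hN0.le]
    refine mul_le_mul_of_nonneg_right ?_ (by positivity)
    calc (2 : ℝ) ^ δ ≤ (2 : ℝ) ^ (1 : ℝ) := Real.rpow_le_rpow_of_exponent_le (by norm_num) hδ1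
      _ = 2 := Real.rpow_one 2
  have h3 : (2 * N) ^ δ / δ ≤ 2 * N ^ δ / δ := div_le_div_of_nonneg_right h2 hδ0.le
  have h4 : (1 + 2 / δ) * N ^ δ = N ^ δ + 2 * N ^ δ / δ := by ring
  rw [h4]; linarith

/-- `(log x)^4 ≤ (4/δ)^4 x^δ` for `x ≥ 1`, `δ > 0`; plumbing. [folklore] -/
private lemma log_pow_four_le {x δ : ℝ} (hx : 1 ≤ x) (hδ0 : 0 < δ) :
    Real.log x ^ 4 ≤ (4 / δ) ^ 4 * x ^ δ := by
  have hx0 : 0 ≤ x := by linarith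
  have hlog0 : 0 ≤ Real.log x := Real.log_nonneg hx
  have h1 : Real.log x ≤ x ^ (δ / 4) / (δ / 4) := Real.log_le_rpow_div hx0 (by positivity)
  have h2 : x ^ (δ / 4) / (δ / 4) = 4 / δ * x ^ (δ / 4) := by
    rw [div_div_eq_mul_div, div_eq_iff hδ0.ne']
    rw [mul_assoc, mul_comm (x ^ (δ / 4)) δ, ← mul_assoc, div_mul_cancel₀ _ hδ0.ne']
    ring
  rw [h2] at h1
  have h3 : (x ^ (δ / 4)) ^ (4 : ℕ) = x ^ δ := by
    rw [← Real.rpow_natCast, ← Real.rpow_mul hx0]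
    norm_num
  calc Real.log x ^ 4 ≤ (4 / δ * x ^ (δ / 4)) ^ 4 := pow_le_pow_left₀ hlog0 h1 4
    _ = (4 / δ) ^ 4 * (x ^ (δ / 4)) ^ 4 := mul_pow _ _ 4
    _ = (4 / δ) ^ 4 * x ^ δ := by rw [h3]

/-- The first Huxley monomial in powers of `N`: `N^δ (2N)(2N) V⁻² ≤ 4 N^{2−2σ+3δ}`; plumbing.
[folklore] -/
private lemma huxley_termA_le {N V σ δ : ℝ} (hN : 1 ≤ N) (hV : N ^ (σ - δ) ≤ V) :
    N ^ δ * ((2 * N) * (2 * N) * V⁻¹ ^ 2) ≤ 4 * N ^ (2 - 2 * σ + 3 * δ) := by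
  have hN0 : 0 < N := by linarith
  have hX2 : V⁻¹ ^ 2 ≤ N ^ (-((σ - δ) * (2 : ℕ))) := inv_pow_le_rpow_neg hN0 hV 2
  calc N ^ δ * ((2 * N) * (2 * N) * V⁻¹ ^ 2)
      ≤ N ^ δ * ((2 * N ^ (1 : ℝ)) * (2 * N ^ (1 : ℝ)) * N ^ (-((σ - δ) * (2 : ℕ)))) := by
        rw [Real.rpow_one]; gcongr
    _ = 4 * N ^ (2 - 2 * σ + 3 * δ) := by
        have : N ^ (2 - 2 * σ + 3 * δ) =
            N ^ δ * (N ^ (1 : ℝ) * N ^ (1 : ℝ) * N ^ (-((σ - δ) * (2 : ℕ)))) := by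
          rw [← Real.rpow_add hN0, ← Real.rpow_add hN0, ← Real.rpow_add hN0]; push_cast; ring_nf
        rw [this]; ring

/-- The second Huxley monomial in powers of `N`:
`N^δ N³ N T V⁻⁶ N^{(1+τ+δ)δ} ≤ N^{4+τ−6σ+(9+τ+δ)δ}` when `T ≤ N^{τ+δ}`, `V ≥ N^{σ−δ}`; plumbing.
[folklore] -/
private lemma huxley_termB_le {N T V σ τ δ : ℝ} (hN : 1 ≤ N) (hT : T ≤ N ^ (τ + δ))
    (hV : N ^ (σ - δ) ≤ V) :
    N ^ δ * N ^ 3 * N * T * V⁻¹ ^ 6 * N ^ ((1 + τ + δ) * δ) ≤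
      N ^ (4 + τ - 6 * σ + (9 + τ + δ) * δ) := by
  have hN0 : 0 < N := by linarith
  have hX6 : V⁻¹ ^ 6 ≤ N ^ (-((σ - δ) * (6 : ℕ))) := inv_pow_le_rpow_neg hN0 hV 6
  have hV0 : 0 < V := lt_of_lt_of_le (Real.rpow_pos_of_pos hN0 _) hV
  have h6 : 0 ≤ V⁻¹ ^ 6 := by positivity
  have hN3 : N ^ 3 = N ^ (3 : ℝ) := by
    rw [← Real.rpow_natCast]; norm_num
  calc N ^ δ * N ^ 3 * N * T * V⁻¹ ^ 6 * N ^ ((1 + τ + δ) * δ)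
      ≤ N ^ δ * N ^ (3 : ℝ) * N ^ (1 : ℝ) * N ^ (τ + δ) * N ^ (-((σ - δ) * (6 : ℕ))) *
          N ^ ((1 + τ + δ) * δ) := by
        rw [Real.rpow_one, ← hN3]; gcongr
    _ = N ^ (4 + τ - 6 * σ + (9 + τ + δ) * δ) := by
        rw [← Real.rpow_add hN0, ← Real.rpow_add hN0, ← Real.rpow_add hN0, ← Real.rpow_add hN0,
          ← Real.rpow_add hN0]; push_cast; ring_nf

/-- **Huxley's large values theorem as the bound `LV(σ, τ) ≤ max(2 − 2σ, 4 + τ − 6σ)`**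
(Tao–Trudgian–Yang, item (i) after Theorem 31: the Huxley large values theorem
`|W| ≪ N^{o(1)}(N²V⁻² + N⁴TV⁻⁶)` gives "`LV(σ,τ) ≤ max(2−2σ, 4 + τ − 6σ)`"), for `τ > 0`, PROVED from
the tree theorem `GuthMaynardReduction.largeValues_hmh` (from `Huxley1972_largeValues_holds`:
`#W ≤ C (1 + log 2N)((N+1)(2N)V⁻² + (N+1)³(2N) T V⁻⁶ log⁴(2NT))`) by the bookkeeping
`1 + log 2N ≤ (1 + 2/δ)N^δ`, `log⁴(2NT) ≤ (4/δ)⁴(2NT)^δ`, `T ≤ N^{τ+δ}`, `V ≥ N^{σ−δ}`,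
`δ = min(τ/2, 1/4, ε/(2(τ+10)))`.
[cite: TaoTrudgianYang2025, item (i) after Theorem 31 (huxley-lvt), p. 13] [cite: Huxley1972, Ch. 28] -/
theorem largeValueBound_huxley {σ τ : ℝ} (hτ : 0 < τ) :
    LargeValueBound σ τ (max (2 - 2 * σ) (4 + τ - 6 * σ)) := by
  intro ε hε
  obtain ⟨M, hM⟩ : ∃ M : ℝ, max (2 - 2 * σ) (4 + τ - 6 * σ) = M := ⟨_, rfl⟩
  have hM1 : 2 - 2 * σ ≤ M := by rw [← hM]; exact le_max_left _ _
  have hM2 : 4 + τ - 6 * σ ≤ M := by rw [← hM]; exact le_max_right _ _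
  rw [hM]
  obtain ⟨C, hC0, hC⟩ := GuthMaynardReduction.largeValues_hmh
  obtain ⟨δ, hδ⟩ : ∃ δ : ℝ, min (τ / 2) (min (1 / 4) (ε / (2 * (τ + 10)))) = δ := ⟨_, rfl⟩
  have hδ0 : 0 < δ := by rw [← hδ]; positivity
  have hδτ : δ ≤ τ / 2 := by rw [← hδ]; exact min_le_left _ _
  have hδ4 : δ ≤ 1 / 4 := by rw [← hδ]; exact (min_le_right _ _).trans (min_le_left _ _)
  have hδε : δ ≤ ε / (2 * (τ + 10)) := by
    rw [← hδ]; exact (min_le_right _ _).trans (min_le_right _ _)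
  have hδε' : δ * (τ + 10) ≤ ε / 2 := by
    rw [le_div_iff₀ (by positivity)] at hδε; linarith
  have hδτ0 : 0 ≤ δ * τ := by positivity
  have hδδ : δ * δ ≤ δ * (1 / 4) := mul_le_mul_of_nonneg_left hδ4 hδ0.le
  obtain ⟨K, hK⟩ : ∃ K : ℝ, C * (1 + 2 / δ) * (4 + 32 * (4 / δ) ^ 4) = K := ⟨_, rfl⟩
  have hK0 : 0 ≤ K := by rw [← hK]; positivity
  refine ⟨max 16 K, δ, hδ0, fun N T V a W hN hT₁ hT₂ hV₁ hV₂ ha hW hsep hla ↦ ?_⟩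
  have hN16 : (16 : ℝ) ≤ N := (le_max_left _ _).trans hN
  have hN1 : (1 : ℝ) ≤ N := by linarith
  have hN0 : (0 : ℝ) < N := by linarith
  have hNnat : 1 ≤ N := by exact_mod_cast hN1
  have hT1 : 1 ≤ T := (Real.one_le_rpow hN1 (by linarith)).trans hT₁
  have hT0 : 0 < T := by linarith
  have hV0 : 0 < V := lt_of_lt_of_le (Real.rpow_pos_of_pos hN0 _) hV₁
  have hR := hC N T V a W hNnat hT1 hV0 ha hW hsep hla
  -- elementary bounds
  have b1 : (N : ℝ) + 1 ≤ 2 * N := by linarith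
  have b3 : 1 + Real.log (2 * (N : ℝ)) ≤ (1 + 2 / δ) * (N : ℝ) ^ δ :=
    one_add_log_le hN1 hδ0 (by linarith)
  have hNT1 : (1 : ℝ) ≤ 2 * N * T := by
    have := mul_le_mul hN1 hT1 zero_le_one hN0.le
    linarith
  have b4 : Real.log (2 * N * T) ^ 4 ≤ (4 / δ) ^ 4 * (2 * N * T) ^ δ := log_pow_four_le hNT1 hδ0
  have b5 : (2 * (N : ℝ) * T) ^ δ ≤ 2 * (N : ℝ) ^ ((1 + τ + δ) * δ) := by
    have h1 : 2 * (N : ℝ) * T ≤ 2 * (N : ℝ) ^ (1 + τ + δ) := by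
      rw [show 1 + τ + δ = 1 + (τ + δ) by ring, Real.rpow_add hN0, Real.rpow_one, mul_assoc]
      exact mul_le_mul_of_nonneg_left (mul_le_mul_of_nonneg_left hT₂ hN0.le) (by norm_num)
    calc (2 * (N : ℝ) * T) ^ δ ≤ (2 * (N : ℝ) ^ (1 + τ + δ)) ^ δ :=
          Real.rpow_le_rpow (by positivity) h1 hδ0.le
      _ = (2 : ℝ) ^ δ * (N : ℝ) ^ ((1 + τ + δ) * δ) := by
          rw [Real.mul_rpow (by norm_num) (by positivity), ← Real.rpow_mul hN0.le]
      _ ≤ 2 * (N : ℝ) ^ ((1 + τ + δ) * δ) := by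
          refine mul_le_mul_of_nonneg_right ?_ (by positivity)
          calc (2 : ℝ) ^ δ ≤ (2 : ℝ) ^ (1 : ℝ) :=
                Real.rpow_le_rpow_of_exponent_le (by norm_num) (by linarith)
            _ = 2 := Real.rpow_one 2
  have hb4' : Real.log (2 * N * T) ^ 4 ≤ (4 / δ) ^ 4 * (2 * (N : ℝ) ^ ((1 + τ + δ) * δ)) :=
    b4.trans (mul_le_mul_of_nonneg_left b5 (by positivity))
  have hlog2N0 : 0 ≤ 1 + Real.log (2 * (N : ℝ)) := by
    have := Real.log_nonneg (by linarith : (1 : ℝ) ≤ 2 * N); linarith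
  -- the two monomials
  have tA : (N : ℝ) ^ δ * ((2 * N) * (2 * N) * V⁻¹ ^ 2) ≤ 4 * (N : ℝ) ^ (M + ε / 2) :=
    (huxley_termA_le hN1 hV₁).trans (mul_le_mul_of_nonneg_left
      (Real.rpow_le_rpow_of_exponent_le hN1 (by linarith)) (by norm_num))
  have tB : (N : ℝ) ^ δ * ((2 * N) ^ 3 * (2 * N) * T * V⁻¹ ^ 6 *
      ((4 / δ) ^ 4 * (2 * (N : ℝ) ^ ((1 + τ + δ) * δ)))) ≤ 32 * (4 / δ) ^ 4 * (N : ℝ) ^ (M + ε / 2) := by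
    have e : (N : ℝ) ^ δ * ((2 * N) ^ 3 * (2 * N) * T * V⁻¹ ^ 6 *
        ((4 / δ) ^ 4 * (2 * (N : ℝ) ^ ((1 + τ + δ) * δ)))) =
        32 * (4 / δ) ^ 4 * ((N : ℝ) ^ δ * (N : ℝ) ^ 3 * N * T * V⁻¹ ^ 6 *
          (N : ℝ) ^ ((1 + τ + δ) * δ)) := by ring
    rw [e]
    refine mul_le_mul_of_nonneg_left ((huxley_termB_le hN1 hT₂ hV₁).trans ?_) (by positivity)
    refine Real.rpow_le_rpow_of_exponent_le hN1 ?_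
    have : (9 + τ + δ) * δ ≤ (τ + 10) * δ := mul_le_mul_of_nonneg_right (by linarith) hδ0.le
    linarith
  -- assemble
  have hmid : (1 + Real.log (2 * (N : ℝ))) *
      (((N : ℝ) + 1) * (2 * N) * V⁻¹ ^ 2 +
        ((N : ℝ) + 1) ^ 3 * (2 * N) * T * V⁻¹ ^ 6 * Real.log (2 * N * T) ^ 4)
      ≤ ((1 + 2 / δ) * (N : ℝ) ^ δ) *
        ((2 * N) * (2 * N) * V⁻¹ ^ 2 + (2 * N) ^ 3 * (2 * N) * T * V⁻¹ ^ 6 *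
          ((4 / δ) ^ 4 * (2 * (N : ℝ) ^ ((1 + τ + δ) * δ)))) := by
    gcongr
  have hfin : (1 + 2 / δ) * (N : ℝ) ^ δ *
      ((2 * N) * (2 * N) * V⁻¹ ^ 2 + (2 * N) ^ 3 * (2 * N) * T * V⁻¹ ^ 6 *
        ((4 / δ) ^ 4 * (2 * (N : ℝ) ^ ((1 + τ + δ) * δ)))) ≤
      (1 + 2 / δ) * ((4 + 32 * (4 / δ) ^ 4) * (N : ℝ) ^ (M + ε / 2)) := by
    rw [mul_assoc]
    refine mul_le_mul_of_nonneg_left ?_ (by positivity)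
    rw [mul_add]
    have := add_le_add tA tB
    linarith
  have hNε : (N : ℝ) ^ (M + ε / 2) ≤ (N : ℝ) ^ (M + ε) :=
    Real.rpow_le_rpow_of_exponent_le hN1 (by linarith)
  calc (W.card : ℝ) ≤ C * (1 + Real.log (2 * (N : ℝ))) *
        (((N : ℝ) + 1) * (2 * N) * V⁻¹ ^ 2 +
          ((N : ℝ) + 1) ^ 3 * (2 * N) * T * V⁻¹ ^ 6 * Real.log (2 * N * T) ^ 4) := hR
    _ ≤ C * ((1 + 2 / δ) * ((4 + 32 * (4 / δ) ^ 4) * (N : ℝ) ^ (M + ε / 2))) := by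
        rw [mul_assoc]; exact mul_le_mul_of_nonneg_left (hmid.trans hfin) hC0
    _ = K * (N : ℝ) ^ (M + ε / 2) := by rw [← hK]; ring
    _ ≤ K * (N : ℝ) ^ (M + ε) := mul_le_mul_of_nonneg_left hNε hK0
    _ ≤ max 16 K * (N : ℝ) ^ (M + ε) := mul_le_mul_of_nonneg_right (le_max_right _ _) (by positivity)

end Literature.NumberTheory.LFunctions

end
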